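import Mathlib.AlgebraicTopology.SingularHomology.Basic
import Mathlib.AlgebraicTopology.SingularHomology.HomotopyInvariance
import Mathlib.AlgebraicTopology.SingularHomology.HomologyZero
import Mathlib.AlgebraicTopology.SimplicialSet.Homology.Basic
import Mathlib.Algebra.Category.ModuleCat.Colimits
import Mathlib.Algebra.Category.ModuleCat.Abelian
import Mathlib.Topology.Homotopy.Equiv
import HarnessLib

-- provenance: harness21/H21/H21/Prelude/AlgTop/SingularChains.lean @ c8b6cdb (interim HEAD d8f2665); M5 mechanical rewrite
/-!
# Singular chains and singular homology (trunk G04 AlgTop, item C1 `SingularChains`)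

A thin, type-level convenience layer over Mathlib's singular chain complex functor
`AlgebraicTopology.singularChainComplexFunctor` and `AlgebraicTopology.singularHomologyFunctor`
(Hatcher, *Algebraic Topology* (2002), §2.1).

Mathlib already provides everything categorical: the singular simplicial set `TopCat.toSSet`,
the simplicial chain complex `SSet.chainComplex` with the summand inclusions `SSet.ιChainComplex`,
`SSet.ιChainComplex_d`, `SSet.chainComplex_hom_ext`, functoriality `SSet.homologyMap_id/comp`,
homotopy invariance `TopCat.Homotopy.congr_homologyMap_singularChainComplexFunctor`, the
augmentation `TopCat.singularHomology₀ε` (an iso for path-connected spaces) and the vanishing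
`AlgebraicTopology.isZero_singularHomologyFunctor_of_totallyDisconnectedSpace`. We do **not**
redefine any of these; this file only fixes the H21 conventions:

* spaces are unbundled `X : Type u` `[TopologicalSpace X]` (bundled internally as `TopCat.of X`),
  maps are `C(X, Y)` (bundled internally as `TopCat.ofHom f`);
* coefficients: a commutative ring `R : Type v` and an `R`-module `M : Type v`; the coefficient object
  handed to Mathlib is `ModuleCat.of R (ULift.{u} M)` and all (co)homology objects live in
  `ModuleCat.{max u v} R`. The `ULift` only surfaces in `singularChainComplex.single` and
  `singularHomology.ε`;
* everything is generic in `R`; `ℤ`/`ℚ` coefficients appear only by instantiation.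

## Main definitions

* `Literature.SingularSimplex X n`: singular `n`-simplices of `X` (`= (TopCat.toSSet.obj (.of X)) _⦋n⦌`),
  with `toContinuousMap`, `face`, `map`.
* `Literature.singularChainComplex R M X`: the singular chain complex `C_•(X; M)`; `single σ m` is the
  elementary chain `m • σ`; `singularChainComplex.map f` the induced chain map.
* `Literature.singularHomology R M X n`: `Hₙ(X; M)`, with `map`, `map_id`, `map_comp`,
  `map_eq_of_homotopic`, `mapIso`, `isoOfHomotopyEquiv`, the augmentation `ε`.

## References

* A. Hatcher, *Algebraic Topology*, CUP 2002, §2.1.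
-/

noncomputable section

open CategoryTheory Limits AlgebraicTopology Simplicial Opposite

universe u v

namespace Literature.AlgebraicTopology.SingularHomology

variable (R : Type v) [CommRing R] (M : Type v) [AddCommGroup M] [Module R M]
variable {X Y Z : Type u} [TopologicalSpace X] [TopologicalSpace Y] [TopologicalSpace Z]

/-! ### Singular simplices -/

variable (X) in
/-- A singular `n`-simplex of the topological space `X`: an `n`-simplex of the singular simplicial
set `TopCat.toSSet.obj (TopCat.of X)`, i.e. (up to `ULift`) a continuous map `Δⁿ → X`
(Hatcher 2002, §2.1). [cite: Hatcher2002, §2.1] -/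
abbrev SingularSimplex (n : ℕ) : Type u := (TopCat.toSSet.obj (TopCat.of X)) _⦋n⦌

namespace SingularSimplex

variable {n : ℕ}

/-- A singular `n`-simplex of `X` is the same as a continuous map from the standard topological
`n`-simplex `stdSimplex ℝ (Fin (n + 1))` to `X` (Hatcher 2002, §2.1); this is Mathlib's
`TopCat.toSSetObjEquiv`. [cite: Hatcher2002, §2.1] -/
def toContinuousMap : SingularSimplex X n ≃ C(stdSimplex ℝ (Fin (n + 1)), X) :=
  TopCat.toSSetObjEquiv (TopCat.of X) (op ⦋n⦌)

/-- The `i`-th face `σ ∘ δᵢ : Δⁿ → X` of a singular `(n+1)`-simplex `σ` (Hatcher 2002, §2.1,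
boundary formula); this is the simplicial face map `SSet.δ i` of the singular simplicial set. [cite: Hatcher2002, §2.1  boundary formula] -/
def face (i : Fin (n + 2)) (σ : SingularSimplex X (n + 1)) : SingularSimplex X n :=
  (TopCat.toSSet.obj (TopCat.of X)).δ i σ

/-- Push-forward `f ∘ σ` of a singular simplex along a continuous map (Hatcher 2002, §2.1,
induced homomorphisms); this is `(TopCat.toSSet.map (TopCat.ofHom f)).app _`. [cite: Hatcher2002, §2.1  induced homomorphisms] -/
def map (f : C(X, Y)) (σ : SingularSimplex X n) : SingularSimplex Y n :=
  (TopCat.toSSet.map (TopCat.ofHom f)).app (op ⦋n⦌) σ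

/-- Push-forward along the identity is the identity (Hatcher 2002, §2.1, `𝟙♯ = 𝟙`). [cite: Hatcher2002, §2.1   𝟙♯ = 𝟙] -/
@[simp]
lemma map_id (σ : SingularSimplex X n) : σ.map (ContinuousMap.id X) = σ := by
  change (TopCat.toSSet.map (𝟙 (TopCat.of X))).app (op ⦋n⦌) σ = σ
  rw [CategoryTheory.Functor.map_id]
  rfl

/-- Push-forward of singular simplices is functorial (Hatcher 2002, §2.1, `(fg)♯ = f♯ g♯`). [cite: Hatcher2002, §2.1   (fg] -/
lemma map_comp (f : C(X, Y)) (g : C(Y, Z)) (σ : SingularSimplex X n) :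
    σ.map (g.comp f) = (σ.map f).map g := by
  change (TopCat.toSSet.map (TopCat.ofHom f ≫ TopCat.ofHom g)).app (op ⦋n⦌) σ = _
  rw [CategoryTheory.Functor.map_comp]
  rfl

/-- Push-forward commutes with faces (naturality of the simplicial structure; Hatcher 2002, §2.1,
`f♯ ∂ = ∂ f♯` at the level of simplices). [cite: Hatcher2002, §2.1   f♯ ∂ = ∂ f♯  at the level of simp] -/
@[simp]
lemma face_map (f : C(X, Y)) (i : Fin (n + 2)) (σ : SingularSimplex X (n + 1)) :
    (σ.map f).face i = (σ.face i).map f :=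
  (SSet.δ_naturality_apply (TopCat.toSSet.map (TopCat.ofHom f)) i σ).symm

end SingularSimplex

/-! ### The singular chain complex -/

variable (X) in
/-- The singular chain complex `C_•(X; M)` of `X` with coefficients in the `R`-module `M`, as an
object of `ChainComplex (ModuleCat.{max u v} R) ℕ` (Hatcher 2002, §2.1). This is Mathlib's
`AlgebraicTopology.singularChainComplexFunctor` evaluated at the coefficient object
`ModuleCat.of R (ULift.{u} M)` and the space `TopCat.of X`; it is definitionally equal to
`(TopCat.toSSet.obj (TopCat.of X)).chainComplex (ModuleCat.of R (ULift M))` (`SSet.chainComplex`,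
`Mathlib/AlgebraicTopology/SimplicialSet/Homology/Basic.lean`), so `Cₙ(X; M) = ⨁_{σ : Δⁿ → X} M`. [cite: Hatcher2002, §2.1] -/
abbrev singularChainComplex : ChainComplex (ModuleCat.{max u v} R) ℕ :=
  ((singularChainComplexFunctor (ModuleCat.{max u v} R)).obj
    (ModuleCat.of R (ULift.{u} M))).obj (TopCat.of X)

namespace singularChainComplex

variable {R M} {n : ℕ}

/-- The `R`-linear map `m ↦ m • σ : M → Cₙ(X; M)`, inclusion of the summand indexed by the singular
simplex `σ` (Hatcher 2002, §2.1); this is `SSet.ιChainComplex σ` precomposed with `ULift.up`. [cite: Hatcher2002, §2.1] -/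
def singleₗ (σ : SingularSimplex X n) : M →ₗ[R] (singularChainComplex R M X).X n :=
  ((TopCat.toSSet.obj (TopCat.of X)).ιChainComplex
      (R := ModuleCat.of R (ULift.{u} M)) σ).hom.comp
    ULift.moduleEquiv.symm.toLinearMap

/-- The elementary singular chain `m • σ ∈ Cₙ(X; M)` (Hatcher 2002, §2.1); equal to
`SSet.ιChainComplex σ (ULift.up m)`. [cite: Hatcher2002, §2.1] -/
def single (σ : SingularSimplex X n) (m : M) : (singularChainComplex R M X).X n :=
  singleₗ (R := R) σ m

/-- `singleₗ σ m = single σ m` by definition (Hatcher 2002, §2.1). [cite: Hatcher2002, §2.1] -/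
@[simp]
lemma singleₗ_apply (σ : SingularSimplex X n) (m : M) :
    singleₗ (R := R) σ m = single (R := R) σ m := rfl

/-- Bridge to Mathlib: `single σ m = SSet.ιChainComplex σ (ULift.up m)` (Hatcher 2002, §2.1). [cite: Hatcher2002, §2.1] -/
lemma single_eq_ιChainComplex (σ : SingularSimplex X n) (m : M) :
    single (R := R) σ m =
      ((TopCat.toSSet.obj (TopCat.of X)).ιChainComplex
        (R := ModuleCat.of R (ULift.{u} M)) σ).hom (ULift.up m) := rfl

/-- The singular boundary formula `∂ (m • σ) = ∑ᵢ (-1)ⁱ m • (σ ∘ δᵢ)` (Hatcher 2002, §2.1,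
formula preceding Lemma 2.1); from `SSet.ιChainComplex_d`. [cite: Hatcher2002, §2.1  formula preceding Lemma 2.1] -/
lemma d_single (σ : SingularSimplex X (n + 1)) (m : M) :
    (singularChainComplex R M X).d (n + 1) n (single (R := R) σ m) =
      ∑ i : Fin (n + 2), ((-1 : R) ^ (i : ℕ)) • single (R := R) (σ.face i) m := by
  have h := congr(($((TopCat.toSSet.obj (TopCat.of X)).ιChainComplex_d
    (R := ModuleCat.of R (ULift.{u} M)) σ)).hom (ULift.up m))
  simp only [ModuleCat.hom_comp, LinearMap.comp_apply, ModuleCat.hom_sum, ModuleCat.hom_zsmul,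
    LinearMap.coe_sum, Finset.sum_apply, LinearMap.smul_apply] at h
  refine h.trans (Finset.sum_congr rfl fun i _ ↦ ?_)
  rw [← Int.cast_smul_eq_zsmul R, Int.cast_pow, Int.cast_neg, Int.cast_one]
  rfl

/-- A morphism out of the module of singular `n`-chains is determined by its values on elementary
chains `m • σ` (`Cₙ(X; M)` is the direct sum `⨁_σ M`; Hatcher 2002, §2.1); from
`SSet.chainComplex_hom_ext`. [cite: Hatcher2002, §2.1] -/
lemma hom_ext {T : ModuleCat.{max u v} R} {φ ψ : (singularChainComplex R M X).X n ⟶ T}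
    (h : ∀ (σ : SingularSimplex X n) (m : M), φ (single (R := R) σ m) = ψ (single (R := R) σ m)) :
    φ = ψ := by
  refine SSet.chainComplex_hom_ext (fun σ ↦ ?_)
  ext ⟨m⟩
  exact h σ m

variable (R M) in
/-- The chain map `f♯ : C_•(X; M) ⟶ C_•(Y; M)` induced by a continuous map (Hatcher 2002, §2.1).
By definition this is the singular chain complex functor applied to `TopCat.ofHom f`. [cite: Hatcher2002, §2.1] -/
abbrev map (f : C(X, Y)) : singularChainComplex R M X ⟶ singularChainComplex R M Y :=
  ((singularChainComplexFunctor (ModuleCat.{max u v} R)).obj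
    (ModuleCat.of R (ULift.{u} M))).map (TopCat.ofHom f)

/-- `f♯ (m • σ) = m • (f ∘ σ)` (Hatcher 2002, §2.1); from `SSet.ι_chainComplexMap_f`. [cite: Hatcher2002, §2.1] -/
@[simp]
lemma map_f_single (f : C(X, Y)) (σ : SingularSimplex X n) (m : M) :
    (map R M f).f n (single (R := R) σ m) = single (R := R) (σ.map f) m :=
  congr(($(SSet.ι_chainComplexMap_f (f := TopCat.toSSet.map (TopCat.ofHom f))
    (R := ModuleCat.of R (ULift.{u} M)) (x := σ))).hom (ULift.up m))

/-- `𝟙♯ = 𝟙` on singular chains (Hatcher 2002, §2.1). [cite: Hatcher2002, §2.1] -/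
@[simp]
lemma map_id : map R M (ContinuousMap.id X) = 𝟙 _ :=
  CategoryTheory.Functor.map_id _ _

/-- `(g ∘ f)♯ = g♯ ∘ f♯` on singular chains (Hatcher 2002, §2.1). [cite: Hatcher2002, §2.1] -/
lemma map_comp (f : C(X, Y)) (g : C(Y, Z)) :
    map R M (g.comp f) = map R M f ≫ map R M g :=
  CategoryTheory.Functor.map_comp _ _ _

end singularChainComplex

/-! ### Singular homology -/

variable (X) in
/-- The `n`-th singular homology `Hₙ(X; M)` of `X` with coefficients in the `R`-module `M`, an object
of `ModuleCat.{max u v} R` (Hatcher 2002, §2.1): the `n`-th homology of `singularChainComplex R M X`.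
Definitionally `SSet.homology` of the singular simplicial set, and equal to
`((singularHomologyFunctor _ n).obj (ModuleCat.of R (ULift M))).obj (TopCat.of X)`. [cite: Hatcher2002, §2.1] -/
abbrev singularHomology (n : ℕ) : ModuleCat.{max u v} R :=
  (singularChainComplex R M X).homology n

namespace singularHomology

/-- The induced map `f_* : Hₙ(X; M) ⟶ Hₙ(Y; M)` of a continuous map (Hatcher 2002, §2.1,
Prop. 2.9 ff.); `HomologicalComplex.homologyMap` of `singularChainComplex.map f`. [cite: Hatcher2002, §2.1  Prop. 2.9 ff] -/
abbrev map (f : C(X, Y)) (n : ℕ) : singularHomology R M X n ⟶ singularHomology R M Y n :=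
  HomologicalComplex.homologyMap (singularChainComplex.map R M f) n

/-- `𝟙_* = 𝟙` (Hatcher 2002, §2.1, property (ii) after Prop. 2.9). [cite: Hatcher2002, §2.1  property (ii] -/
@[simp]
lemma map_id (n : ℕ) : map R M (ContinuousMap.id X) n = 𝟙 _ := by
  rw [map, singularChainComplex.map_id, HomologicalComplex.homologyMap_id]

/-- `(g ∘ f)_* = g_* ∘ f_*` (Hatcher 2002, §2.1, property (i) after Prop. 2.9). [cite: Hatcher2002, §2.1  property (i] -/
@[reassoc]
lemma map_comp (f : C(X, Y)) (g : C(Y, Z)) (n : ℕ) :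
    map R M (g.comp f) n = map R M f n ≫ map R M g n := by
  rw [map, singularChainComplex.map_comp, HomologicalComplex.homologyMap_comp]

/-- Homotopy invariance: homotopic maps induce the same map on singular homology
(Hatcher 2002, Thm. 2.10); from `TopCat.Homotopy.congr_homologyMap_singularChainComplexFunctor`. [cite: Hatcher2002, Thm. 2.10] -/
lemma map_eq_of_homotopic {f g : C(X, Y)} (h : f.Homotopic g) (n : ℕ) :
    map R M f n = map R M g n :=
  TopCat.Homotopy.congr_homologyMap_singularChainComplexFunctor
    (f := TopCat.ofHom f) (g := TopCat.ofHom g) h.some _ n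

/-- A homeomorphism induces an isomorphism `Hₙ(X; M) ≅ Hₙ(Y; M)` (Hatcher 2002, §2.1, remark
after Prop. 2.9). [cite: Hatcher2002, §2.1  remark after Prop. 2.9] -/
@[simps]
def mapIso (e : X ≃ₜ Y) (n : ℕ) : singularHomology R M X n ≅ singularHomology R M Y n where
  hom := map R M e n
  inv := map R M e.symm n
  hom_inv_id := by
    rw [← map_comp]
    exact (congrArg (map R M · n) (by ext x; exact e.symm_apply_apply x)).trans (map_id R M n)
  inv_hom_id := by
    rw [← map_comp]
    exact (congrArg (map R M · n) (by ext x; exact e.apply_symm_apply x)).trans (map_id R M n)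

/-- A homotopy equivalence induces an isomorphism `Hₙ(X; M) ≅ Hₙ(Y; M)` (Hatcher 2002,
Cor. 2.11). [cite: Hatcher2002, Cor. 2.11] -/
@[simps]
def isoOfHomotopyEquiv (e : ContinuousMap.HomotopyEquiv X Y) (n : ℕ) :
    singularHomology R M X n ≅ singularHomology R M Y n where
  hom := map R M e.toFun n
  inv := map R M e.invFun n
  hom_inv_id := by rw [← map_comp, map_eq_of_homotopic R M e.left_inv, map_id]
  inv_hom_id := by rw [← map_comp, map_eq_of_homotopic R M e.right_inv, map_id]

variable (X) in
/-- The augmentation `ε : H₀(X; M) ⟶ M` (up to `ULift`), summing coefficients (Hatcher 2002, §2.1,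
proof of Prop. 2.7); this is Mathlib's `TopCat.singularHomology₀ε`. [cite: Hatcher2002, §2.1  proof of Prop. 2.7] -/
def ε : singularHomology R M X 0 ⟶ ModuleCat.of R (ULift.{u} M) :=
  TopCat.singularHomology₀ε (TopCat.of X) (ModuleCat.of R (ULift.{u} M))

/-- For a nonempty path-connected space, `ε : H₀(X; M) ⟶ M` is an isomorphism (Hatcher 2002,
Prop. 2.7); restates Mathlib's instance for `TopCat.singularHomology₀ε`. [cite: Hatcher2002, Prop. 2.7] -/
theorem isIso_ε_of_pathConnectedSpace [PathConnectedSpace X] : IsIso (ε R M X) :=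
  inferInstanceAs (IsIso (TopCat.singularHomology₀ε (TopCat.of X) _))

end singularHomology

/-- The positive-degree singular homology of a totally disconnected space (e.g. a point) vanishes
(Hatcher 2002, Prop. 2.8 and Prop. 2.6); from
`AlgebraicTopology.isZero_singularHomologyFunctor_of_totallyDisconnectedSpace`. [cite: Hatcher2002, Prop. 2.8 and Prop. 2.6] -/
theorem isZero_singularHomology_of_totallyDisconnectedSpace [TotallyDisconnectedSpace X] {n : ℕ}
    (hn : n ≠ 0) : IsZero (singularHomology R M X n) :=
  isZero_singularHomologyFunctor_of_totallyDisconnectedSpace _ n _ (TopCat.of X) hn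

/-- The positive-degree singular homology of a point (a subsingleton space) vanishes
(Hatcher 2002, Prop. 2.8: `Hₙ(pt) = 0` for `n > 0`). [cite: Hatcher2002, Prop. 2.8:  Hₙ(pt] -/
theorem isZero_singularHomology_of_subsingleton [Subsingleton X] {n : ℕ} (hn : n ≠ 0) :
    IsZero (singularHomology R M X n) :=
  isZero_singularHomology_of_totallyDisconnectedSpace R M hn

end Literature.AlgebraicTopology.SingularHomology
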